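import Summits.Parity.GeneralizedHardyLittlewood.Theorems.GreenTaoLevelTwoGITwoCyclicInverseTorusRealisation
import Summits.Parity.GeneralizedHardyLittlewood.Theorems.GreenTaoLevelTwoGITwoCyclicInverseCircleRealisation

/-!
# Route `GreenTaoLevelTwo`, crux `GITwo` (stmt-Parity-21275), line `birth`, stub `stub_cyclicInverse`:
# the bracket functions `χ(x)e(sx)` and `χ(x)χ(y)e(sxy)` of GT08a arXiv Lemma 69

Sixty-sixth helper file toward the XL stub `stub_cyclicInverse` (B. Green, T. Tao, *An inverse
theorem for the Gowers `U³(G)` norm*, arXiv:math/0503014, Thm. 68 = PEMS 51 (2008) Thm. 12.8).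
Block E16 (arXiv §12, proof of Lemma 69): "`F(x,y) := χ(x) e(sx) e(y)` where we identify `x ∈ ℝ/ℤ`
with a real number from `−1/2` to `1/2` in the usual manner. It is not hard to check that `F` is
`50`-Lipschitz" and "`F(x,y) := χ(x)χ(y)e(sxy)` when `−1/2 < x, y ≤ 1/2`".  With a circle cutoff `κ`
vanishing on `‖a‖ ≥ r₂` (`r₂ < ½`, `…CircleCutoff`) the functions are built with
`AddCircle.liftIoc 1 (−½)` (representatives in `(−½,½]`), the phase being `e(v) = toCircle(v)`:

* `liftIoc_coe_eq` — value of a lifted function at `↑x`, `|x| ≤ ½`, when the integrand vanishes at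
  `x = ±½`-representatives consistently (here: through the factor `κ`);
* `bracketLinear_*` — `Ψ₁(a) = κ(a) e(s x_a)`: values, `1`-boundedness, vanishing, and the Lipschitz
  bound `(L_κ + 2π|s| + 2/(½−r₂))` on `ℝ/ℤ` (seam lemma);
* `bracketQuad_*` — `Ψ₂(a,b) = κ(a)κ(b) e(s x_a x_b)`: the same, Lipschitz
  `2(L_κ + 2π|s| + 2/(½−r₂))` for the max metric (two-variable seam lemma).
Realisation as nilsequences is then `exists_circle_realisation` / `exists_torus_realisation`.

References: [GreenTao2008U3Inverse] arXiv:math/0503014, §12, proof of Lemma 69.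
-/

noncomputable section

namespace Summit.Parity.GeneralizedHardyLittlewood.GreenTaoLevelTwoGITwoCyclicInverse

open Literature.NumberTheory.Sieve

/-- `‖(t : ℝ/ℤ)‖ ≤ |t|`. [folklore] -/
theorem norm_coe_le_abs_real (t : ℝ) : ‖(t : AddCircle (1 : ℝ))‖ ≤ |t| := by
  rw [UnitAddCircle.norm_eq]
  have h := round_le t 0
  rwa [Int.cast_zero, sub_zero] at h

/-- The phase `e(v) = toCircle(v mod 1)` is `2π`-Lipschitz in `v ∈ ℝ`. [folklore] -/
theorem norm_toCircle_coe_sub_le (v w : ℝ) :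
    ‖((AddCircle.toCircle ((v : ℝ) : AddCircle (1 : ℝ)) : Circle) : ℂ) -
        ((AddCircle.toCircle ((w : ℝ) : AddCircle (1 : ℝ)) : Circle) : ℂ)‖ ≤ 2 * Real.pi * |v - w| := by
  refine (norm_toCircle_sub_toCircle_le _ _).trans ?_
  rw [← AddCircle.coe_sub]
  exact mul_le_mul_of_nonneg_left (norm_coe_le_abs_real _) Real.two_pi_pos.le

/-- The phase as an exponential: `toCircle(v mod 1) = exp(2πi v)`. [folklore] -/
theorem toCircle_coe_eq_exp (v : ℝ) :
    ((AddCircle.toCircle ((v : ℝ) : AddCircle (1 : ℝ)) : Circle) : ℂ) =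
      Complex.exp (2 * Real.pi * Complex.I * (v : ℂ)) := by
  rw [AddCircle.toCircle_apply_mk, Circle.coe_exp]
  congr 1; push_cast; ring

/-- Values of a function lifted along `(−½, ½]` at a representative `|x| ≤ ½`, for integrands of the
form `κ(↑x) · G x` with `κ` vanishing at the seam (`κ(a) = 0` for `‖a‖ ≥ r₂`, `r₂ ≤ ½`).
[folklore] -/
theorem liftIoc_coe_eq {κ : AddCircle (1 : ℝ) → ℝ} {r₂ : ℝ} (hr : r₂ ≤ 1 / 2)
    (hκ0 : ∀ a, r₂ ≤ ‖a‖ → κ a = 0) (G : ℝ → ℂ) {x : ℝ} (hx : |x| ≤ 1 / 2) :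
    AddCircle.liftIoc 1 (-(1 / 2)) (fun y : ℝ => (κ (y : AddCircle (1 : ℝ)) : ℂ) * G y)
        (x : AddCircle (1 : ℝ)) = (κ (x : AddCircle (1 : ℝ)) : ℂ) * G x := by
  rcases (abs_le.1 hx).1.eq_or_lt with h | h
  · -- `x = −½`: both sides vanish
    have hnorm : ‖(x : AddCircle (1 : ℝ))‖ = 1 / 2 := by
      rw [norm_coe_eq_abs_of_le hx, ← h, abs_neg]; norm_num
    have hκx : κ (x : AddCircle (1 : ℝ)) = 0 := hκ0 _ (by rw [hnorm]; exact hr)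
    have e : ((x : ℝ) : AddCircle (1 : ℝ)) = (((1 / 2 : ℝ)) : AddCircle (1 : ℝ)) := by
      have := AddCircle.coe_add_period (1 : ℝ) x
      rw [← this, ← h]; norm_num
    have hmem : (1 / 2 : ℝ) ∈ Set.Ioc (-(1 / 2) : ℝ) (-(1 / 2) + 1) := by
      constructor <;> norm_num
    rw [hκx, e, AddCircle.liftIoc_coe_apply hmem]
    have hκ' : κ (((1 / 2 : ℝ)) : AddCircle (1 : ℝ)) = 0 := by rw [← e, hκx]
    rw [hκ']; simp
  · have hmem : x ∈ Set.Ioc (-(1 / 2) : ℝ) (-(1 / 2) + 1) := ⟨h, by linarith [(abs_le.1 hx).2]⟩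
    exact AddCircle.liftIoc_coe_apply hmem

/-- Core estimate: `‖κ(x)e(v) − κ(x')e(w)‖ ≤ L_κ|x − x'| + 2π|v − w|` for a `[0,1]`-valued
`L_κ`-Lipschitz `κ` on `ℝ/ℤ`. [folklore] -/
theorem norm_kappa_mul_phase_sub_le {κ : AddCircle (1 : ℝ) → ℝ} {Lκ : ℝ}
    (hκ : ∀ a, 0 ≤ κ a ∧ κ a ≤ 1) (hκL : ∀ a b, |κ a - κ b| ≤ Lκ * dist a b) (hLκ : 0 ≤ Lκ)
    (x x' v w : ℝ) :
    ‖(κ (x : AddCircle (1 : ℝ)) : ℂ) * ((AddCircle.toCircle ((v : ℝ) : AddCircle (1 : ℝ)) : Circle) : ℂ) -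
        (κ (x' : AddCircle (1 : ℝ)) : ℂ) *
          ((AddCircle.toCircle ((w : ℝ) : AddCircle (1 : ℝ)) : Circle) : ℂ)‖ ≤
      Lκ * |x - x'| + 2 * Real.pi * |v - w| := by
  set A := (κ (x : AddCircle (1 : ℝ)) : ℂ)
  set A' := (κ (x' : AddCircle (1 : ℝ)) : ℂ)
  set E := ((AddCircle.toCircle ((v : ℝ) : AddCircle (1 : ℝ)) : Circle) : ℂ)
  set E' := ((AddCircle.toCircle ((w : ℝ) : AddCircle (1 : ℝ)) : Circle) : ℂ)
  have hA : ‖A - A'‖ ≤ Lκ * |x - x'| := by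
    rw [← Complex.ofReal_sub, Complex.norm_real, Real.norm_eq_abs]
    refine (hκL _ _).trans (mul_le_mul_of_nonneg_left ?_ hLκ)
    rw [dist_eq_norm, ← AddCircle.coe_sub]; exact norm_coe_le_abs_real _
  have hE : ‖E - E'‖ ≤ 2 * Real.pi * |v - w| := norm_toCircle_coe_sub_le _ _
  have hA'1 : ‖A'‖ ≤ 1 := by
    rw [Complex.norm_real, Real.norm_eq_abs, abs_of_nonneg (hκ _).1]; exact (hκ _).2
  have hE1 : ‖E‖ = 1 := Circle.norm_coe _
  calc ‖A * E - A' * E'‖ = ‖(A - A') * E + A' * (E - E')‖ := by ring_nf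
    _ ≤ ‖(A - A') * E‖ + ‖A' * (E - E')‖ := norm_add_le _ _
    _ = ‖A - A'‖ * 1 + ‖A'‖ * ‖E - E'‖ := by rw [norm_mul, norm_mul, hE1]
    _ ≤ Lκ * |x - x'| * 1 + 1 * (2 * Real.pi * |v - w|) :=
        add_le_add (mul_le_mul_of_nonneg_right hA zero_le_one)
          (mul_le_mul hA'1 hE (norm_nonneg _) zero_le_one)
    _ = Lκ * |x - x'| + 2 * Real.pi * |v - w| := by ring

section Linear

variable {κ : AddCircle (1 : ℝ) → ℝ} {r₂ Lκ : ℝ} (s : ℝ)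

/-- **`Ψ₁(a) = κ(a)e(s x_a)`, values at representatives.** [cite: GreenTao2008U3Inverse, §12, proof of Lemma 69] -/
theorem bracketLinear_coe (hr : r₂ ≤ 1 / 2) (hκ0 : ∀ a, r₂ ≤ ‖a‖ → κ a = 0) {x : ℝ}
    (hx : |x| ≤ 1 / 2) :
    AddCircle.liftIoc 1 (-(1 / 2)) (fun y : ℝ => (κ (y : AddCircle (1 : ℝ)) : ℂ) *
        ((AddCircle.toCircle ((s * y : ℝ) : AddCircle (1 : ℝ)) : Circle) : ℂ)) (x : AddCircle (1 : ℝ)) =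
      (κ (x : AddCircle (1 : ℝ)) : ℂ) *
        ((AddCircle.toCircle ((s * x : ℝ) : AddCircle (1 : ℝ)) : Circle) : ℂ) :=
  liftIoc_coe_eq hr hκ0 _ hx

/-- `Ψ₁` is `1`-bounded. [cite: GreenTao2008U3Inverse, §12, proof of Lemma 69] -/
theorem norm_bracketLinear_le (hκ : ∀ a, 0 ≤ κ a ∧ κ a ≤ 1) (a : AddCircle (1 : ℝ)) :
    ‖AddCircle.liftIoc 1 (-(1 / 2)) (fun y : ℝ => (κ (y : AddCircle (1 : ℝ)) : ℂ) *
        ((AddCircle.toCircle ((s * y : ℝ) : AddCircle (1 : ℝ)) : Circle) : ℂ)) a‖ ≤ 1 := by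
  obtain ⟨x, rfl, -, hx⟩ := exists_rep_abs_eq_norm a
  -- evaluate through a representative in `(−½, ½]`
  have : ∃ x' : ℝ, ((x' : ℝ) : AddCircle (1 : ℝ)) = (x : AddCircle (1 : ℝ)) ∧
      x' ∈ Set.Ioc (-(1 / 2) : ℝ) (-(1 / 2) + 1) := by
    rcases (abs_le.1 hx).1.eq_or_lt with h | h
    · refine ⟨x + 1, AddCircle.coe_add_period (1 : ℝ) x, ?_⟩
      constructor <;> linarith
    · exact ⟨x, rfl, h, by linarith [(abs_le.1 hx).2]⟩
  obtain ⟨x', hx', hmem⟩ := this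
  rw [← hx', AddCircle.liftIoc_coe_apply hmem, norm_mul, Circle.norm_coe, mul_one,
    Complex.norm_real, Real.norm_eq_abs, abs_of_nonneg (hκ _).1]
  exact (hκ _).2

/-- `Ψ₁` vanishes near the seam. [cite: GreenTao2008U3Inverse, §12, proof of Lemma 69] -/
theorem bracketLinear_eq_zero (hr : r₂ ≤ 1 / 2) (hκ0 : ∀ a, r₂ ≤ ‖a‖ → κ a = 0)
    (a : AddCircle (1 : ℝ)) (ha : r₂ ≤ ‖a‖) :
    AddCircle.liftIoc 1 (-(1 / 2)) (fun y : ℝ => (κ (y : AddCircle (1 : ℝ)) : ℂ) *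
        ((AddCircle.toCircle ((s * y : ℝ) : AddCircle (1 : ℝ)) : Circle) : ℂ)) a = 0 := by
  obtain ⟨x, rfl, -, hx⟩ := exists_rep_abs_eq_norm a
  rw [bracketLinear_coe s hr hκ0 hx, hκ0 _ ha]; simp

/-- `Ψ₁` is Lipschitz along representatives: constant `L_κ + 2π|s|`.
[cite: GreenTao2008U3Inverse, §12, proof of Lemma 69] -/
theorem norm_bracketLinear_coe_sub_le (hr : r₂ ≤ 1 / 2) (hκ : ∀ a, 0 ≤ κ a ∧ κ a ≤ 1)
    (hκ0 : ∀ a, r₂ ≤ ‖a‖ → κ a = 0) (hκL : ∀ a b, |κ a - κ b| ≤ Lκ * dist a b) (hLκ : 0 ≤ Lκ)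
    {x y : ℝ} (hx : |x| ≤ 1 / 2) (hy : |y| ≤ 1 / 2) :
    ‖AddCircle.liftIoc 1 (-(1 / 2)) (fun y : ℝ => (κ (y : AddCircle (1 : ℝ)) : ℂ) *
          ((AddCircle.toCircle ((s * y : ℝ) : AddCircle (1 : ℝ)) : Circle) : ℂ)) (x : AddCircle (1 : ℝ)) -
        AddCircle.liftIoc 1 (-(1 / 2)) (fun y : ℝ => (κ (y : AddCircle (1 : ℝ)) : ℂ) *
          ((AddCircle.toCircle ((s * y : ℝ) : AddCircle (1 : ℝ)) : Circle) : ℂ)) (y : AddCircle (1 : ℝ))‖ ≤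
      (Lκ + 2 * Real.pi * |s|) * |x - y| := by
  rw [bracketLinear_coe s hr hκ0 hx, bracketLinear_coe s hr hκ0 hy]
  refine (norm_kappa_mul_phase_sub_le hκ hκL hLκ x y (s * x) (s * y)).trans (le_of_eq ?_)
  rw [← mul_sub, abs_mul]; ring

/-- **`Ψ₁(a) = κ(a)e(s x_a)` is Lipschitz on `ℝ/ℤ`** with constant `L_κ + 2π|s| + 2/(½ − r₂)`.
[cite: GreenTao2008U3Inverse, §12, proof of Lemma 69] -/
theorem norm_bracketLinear_sub_le (hr : r₂ < 1 / 2) (hκ : ∀ a, 0 ≤ κ a ∧ κ a ≤ 1)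
    (hκ0 : ∀ a, r₂ ≤ ‖a‖ → κ a = 0) (hκL : ∀ a b, |κ a - κ b| ≤ Lκ * dist a b) (hLκ : 0 ≤ Lκ)
    (a b : AddCircle (1 : ℝ)) :
    ‖AddCircle.liftIoc 1 (-(1 / 2)) (fun y : ℝ => (κ (y : AddCircle (1 : ℝ)) : ℂ) *
          ((AddCircle.toCircle ((s * y : ℝ) : AddCircle (1 : ℝ)) : Circle) : ℂ)) a -
        AddCircle.liftIoc 1 (-(1 / 2)) (fun y : ℝ => (κ (y : AddCircle (1 : ℝ)) : ℂ) *
          ((AddCircle.toCircle ((s * y : ℝ) : AddCircle (1 : ℝ)) : Circle) : ℂ)) b‖ ≤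
      (Lκ + 2 * Real.pi * |s| + 2 / (1 / 2 - r₂)) * dist a b :=
  norm_sub_le_of_vanishing_near_seam hr (by positivity) (norm_bracketLinear_le s hκ)
    (bracketLinear_eq_zero s hr.le hκ0)
    (fun x y hx hy _ => norm_bracketLinear_coe_sub_le s hr.le hκ hκ0 hκL hLκ hx hy) a b

end Linear

section Quad

variable {κ : AddCircle (1 : ℝ) → ℝ} {r₂ Lκ : ℝ} (s : ℝ)

/-- **`Ψ₂(a,b) = κ(a)κ(b)e(s x_a x_b)`, values at representatives `|x|, |y| ≤ ½`.**
[cite: GreenTao2008U3Inverse, §12, proof of Lemma 69] -/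
theorem bracketQuad_coe (hr : r₂ ≤ 1 / 2) (hκ0 : ∀ a, r₂ ≤ ‖a‖ → κ a = 0) {x y : ℝ}
    (hx : |x| ≤ 1 / 2) (hy : |y| ≤ 1 / 2) :
    AddCircle.liftIoc 1 (-(1 / 2)) (fun x' : ℝ => (κ (x' : AddCircle (1 : ℝ)) : ℂ) *
        AddCircle.liftIoc 1 (-(1 / 2)) (fun y' : ℝ => (κ (y' : AddCircle (1 : ℝ)) : ℂ) *
          ((AddCircle.toCircle ((s * x' * y' : ℝ) : AddCircle (1 : ℝ)) : Circle) : ℂ))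
          (y : AddCircle (1 : ℝ))) (x : AddCircle (1 : ℝ)) =
      (κ (x : AddCircle (1 : ℝ)) : ℂ) * ((κ (y : AddCircle (1 : ℝ)) : ℂ) *
        ((AddCircle.toCircle ((s * x * y : ℝ) : AddCircle (1 : ℝ)) : Circle) : ℂ)) := by
  rw [liftIoc_coe_eq hr hκ0 _ hx, liftIoc_coe_eq hr hκ0 _ hy]

/-- `Ψ₂(a, ↑y)` through a representative of `a` only (inner variable at a representative
`|y| ≤ ½`). [folklore] -/
theorem bracketQuad_coe_right (hr : r₂ ≤ 1 / 2) (hκ0 : ∀ a, r₂ ≤ ‖a‖ → κ a = 0)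
    (a : AddCircle (1 : ℝ)) {y : ℝ} (hy : |y| ≤ 1 / 2) :
    ∃ x : ℝ, (x : AddCircle (1 : ℝ)) = a ∧ |x| = ‖a‖ ∧ |x| ≤ 1 / 2 ∧
      AddCircle.liftIoc 1 (-(1 / 2)) (fun x' : ℝ => (κ (x' : AddCircle (1 : ℝ)) : ℂ) *
        AddCircle.liftIoc 1 (-(1 / 2)) (fun y' : ℝ => (κ (y' : AddCircle (1 : ℝ)) : ℂ) *
          ((AddCircle.toCircle ((s * x' * y' : ℝ) : AddCircle (1 : ℝ)) : Circle) : ℂ))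
          (y : AddCircle (1 : ℝ))) a =
      (κ (x : AddCircle (1 : ℝ)) : ℂ) * ((κ (y : AddCircle (1 : ℝ)) : ℂ) *
        ((AddCircle.toCircle ((s * x * y : ℝ) : AddCircle (1 : ℝ)) : Circle) : ℂ)) := by
  obtain ⟨x, rfl, hxa, hx⟩ := exists_rep_abs_eq_norm a
  exact ⟨x, rfl, hxa, hx, bracketQuad_coe s hr hκ0 hx hy⟩

/-- **`Ψ₂` is Lipschitz for the max metric** with constant `2(L_κ + 2π|s| + 2/(½ − r₂))`, is
`1`-bounded, and vanishes when `‖a‖ ≥ r₂` or `‖b‖ ≥ r₂` (any real `s`; Lemma 69 uses `|s| ≤ ½`).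
[cite: GreenTao2008U3Inverse, §12, proof of Lemma 69] -/
theorem bracketQuad_bounds (hr : r₂ < 1 / 2) (hκ : ∀ a, 0 ≤ κ a ∧ κ a ≤ 1)
    (hκ0 : ∀ a, r₂ ≤ ‖a‖ → κ a = 0) (hκL : ∀ a b, |κ a - κ b| ≤ Lκ * dist a b) (hLκ : 0 ≤ Lκ) :
    let Ψ : AddCircle (1 : ℝ) → AddCircle (1 : ℝ) → ℂ := fun a b =>
      AddCircle.liftIoc 1 (-(1 / 2)) (fun x' : ℝ => (κ (x' : AddCircle (1 : ℝ)) : ℂ) *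
        AddCircle.liftIoc 1 (-(1 / 2)) (fun y' : ℝ => (κ (y' : AddCircle (1 : ℝ)) : ℂ) *
          ((AddCircle.toCircle ((s * x' * y' : ℝ) : AddCircle (1 : ℝ)) : Circle) : ℂ)) b) a
    (∀ a b, ‖Ψ a b‖ ≤ 1) ∧ (∀ a b, r₂ ≤ ‖a‖ → Ψ a b = 0) ∧ (∀ a b, r₂ ≤ ‖b‖ → Ψ a b = 0) ∧
      ∀ a b a' b', ‖Ψ a b - Ψ a' b'‖ ≤
        2 * (Lκ + 2 * Real.pi * |s| + 2 / (1 / 2 - r₂)) * max (dist a a') (dist b b') := by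
  intro Ψ
  -- values through representatives
  have hval : ∀ a b : AddCircle (1 : ℝ), ∃ x y : ℝ, (x : AddCircle (1 : ℝ)) = a ∧
      (y : AddCircle (1 : ℝ)) = b ∧ |x| = ‖a‖ ∧ |y| = ‖b‖ ∧ |x| ≤ 1 / 2 ∧ |y| ≤ 1 / 2 ∧
      Ψ a b = (κ (x : AddCircle (1 : ℝ)) : ℂ) * ((κ (y : AddCircle (1 : ℝ)) : ℂ) *
        ((AddCircle.toCircle ((s * x * y : ℝ) : AddCircle (1 : ℝ)) : Circle) : ℂ)) := by
    intro a b
    obtain ⟨y, rfl, hyb, hy⟩ := exists_rep_abs_eq_norm b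
    obtain ⟨x, hxa', hxa, hx, hv⟩ := bracketQuad_coe_right s hr.le hκ0 a hy
    exact ⟨x, y, hxa', rfl, hxa, hyb, hx, hy, hv⟩
  have hκC : ∀ z : ℝ, ‖(κ (z : AddCircle (1 : ℝ)) : ℂ)‖ ≤ 1 := fun z => by
    rw [Complex.norm_real, Real.norm_eq_abs, abs_of_nonneg (hκ _).1]; exact (hκ _).2
  have hb : ∀ a b, ‖Ψ a b‖ ≤ 1 := by
    intro a b
    obtain ⟨x, y, -, -, -, -, -, -, hv⟩ := hval a b
    rw [hv, norm_mul, norm_mul, Circle.norm_coe, mul_one]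
    calc ‖(κ (x : AddCircle (1 : ℝ)) : ℂ)‖ * ‖(κ (y : AddCircle (1 : ℝ)) : ℂ)‖ ≤ 1 * 1 :=
          mul_le_mul (hκC x) (hκC y) (norm_nonneg _) zero_le_one
      _ = 1 := one_mul 1
  have hvan₁ : ∀ a b, r₂ ≤ ‖a‖ → Ψ a b = 0 := by
    intro a b ha
    obtain ⟨x, y, hxa', -, -, -, -, -, hv⟩ := hval a b
    rw [hv, hκ0 _ (by rw [hxa']; exact ha)]; simp
  have hvan₂ : ∀ a b, r₂ ≤ ‖b‖ → Ψ a b = 0 := by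
    intro a b hb'
    obtain ⟨x, y, -, hyb', -, -, -, -, hv⟩ := hval a b
    rw [hv, hκ0 (y : AddCircle (1 : ℝ)) (by rw [hyb']; exact hb')]; simp
  refine ⟨hb, hvan₁, hvan₂, ?_⟩
  have hπ : 0 ≤ 2 * Real.pi * |s| := by positivity
  refine norm_sub_le_of_vanishing_near_seam₂ hr (add_nonneg hLκ hπ) hb hvan₁ hvan₂ ?_ ?_
  · -- slice in the first variable
    intro b x x' hx hx' _
    obtain ⟨y, rfl, -, hy⟩ := exists_rep_abs_eq_norm b
    have e1 : Ψ (x : AddCircle (1 : ℝ)) (y : AddCircle (1 : ℝ)) = _ := bracketQuad_coe s hr.le hκ0 hx hy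
    have e2 : Ψ (x' : AddCircle (1 : ℝ)) (y : AddCircle (1 : ℝ)) = _ :=
      bracketQuad_coe s hr.le hκ0 hx' hy
    rw [e1, e2, mul_left_comm, mul_left_comm (κ (x' : AddCircle (1 : ℝ)) : ℂ), ← mul_sub, norm_mul]
    calc ‖(κ (y : AddCircle (1 : ℝ)) : ℂ)‖ * _ ≤ 1 * (Lκ * |x - x'| + 2 * Real.pi * |s * x * y - s * x' * y|) :=
          mul_le_mul (hκC y) (norm_kappa_mul_phase_sub_le hκ hκL hLκ x x' _ _) (norm_nonneg _)
            zero_le_one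
      _ ≤ (Lκ + 2 * Real.pi * |s|) * |x - x'| := by
          rw [one_mul, show s * x * y - s * x' * y = (s * y) * (x - x') by ring, abs_mul, abs_mul]
          have h1 : |s| * |y| ≤ |s| * 1 := mul_le_mul_of_nonneg_left (by linarith) (abs_nonneg _)
          have h2 : |s| * |y| * |x - x'| ≤ |s| * 1 * |x - x'| :=
            mul_le_mul_of_nonneg_right h1 (abs_nonneg _)
          have h3 := mul_le_mul_of_nonneg_left h2 Real.two_pi_pos.le
          rw [mul_one] at h3
          linarith
  · -- slice in the second variable
    intro a y y' hy hy' _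
    obtain ⟨x, hxa', -, hx, e1⟩ := bracketQuad_coe_right s hr.le hκ0 a hy
    -- both representatives describe the same point `a`; use the value formula with `x` for both
    have e2' : Ψ a (y' : AddCircle (1 : ℝ)) = (κ (x : AddCircle (1 : ℝ)) : ℂ) *
        ((κ (y' : AddCircle (1 : ℝ)) : ℂ) *
          ((AddCircle.toCircle ((s * x * y' : ℝ) : AddCircle (1 : ℝ)) : Circle) : ℂ)) := by
      rw [← hxa']; exact bracketQuad_coe s hr.le hκ0 hx hy'
    have e1' : Ψ a (y : AddCircle (1 : ℝ)) = (κ (x : AddCircle (1 : ℝ)) : ℂ) *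
        ((κ (y : AddCircle (1 : ℝ)) : ℂ) *
          ((AddCircle.toCircle ((s * x * y : ℝ) : AddCircle (1 : ℝ)) : Circle) : ℂ)) := e1
    rw [e1', e2', ← mul_sub, norm_mul]
    calc ‖(κ (x : AddCircle (1 : ℝ)) : ℂ)‖ * _ ≤ 1 * (Lκ * |y - y'| + 2 * Real.pi * |s * x * y - s * x * y'|) :=
          mul_le_mul (hκC x) (norm_kappa_mul_phase_sub_le hκ hκL hLκ y y' _ _) (norm_nonneg _)
            zero_le_one
      _ ≤ (Lκ + 2 * Real.pi * |s|) * |y - y'| := by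
          rw [one_mul, show s * x * y - s * x * y' = (s * x) * (y - y') by ring, abs_mul, abs_mul]
          have h1 : |s| * |x| ≤ |s| * 1 := mul_le_mul_of_nonneg_left (by linarith) (abs_nonneg _)
          have h2 : |s| * |x| * |y - y'| ≤ |s| * 1 * |y - y'| :=
            mul_le_mul_of_nonneg_right h1 (abs_nonneg _)
          have h3 := mul_le_mul_of_nonneg_left h2 Real.two_pi_pos.le
          rw [mul_one] at h3
          linarith

end Quad

end Summit.Parity.GeneralizedHardyLittlewood.GreenTaoLevelTwoGITwoCyclicInverse
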